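import Literature.Computability.Complexity.AvgPRel
import Literature.Computability.QuantumComplexity.OracleSeparations
import Literature.Computability.QuantumComplexity.AaronsonAmbainis
import Literature.Computability.Complexity.Counting
import Literature.Computability.Complexity.ProbabilisticClasses
import HarnessLib

/-!
# Barrier catalogue `QuantumAdvantage`: the random-oracle method (Fortnow–Rogers 1999, Thm. 4.4; Aaronson–Ambainis 2014, Thm. 7 (iii))

D-0021 barrier entry for the summit `QuantumAdvantage`
(`Summits/QuantumAdvantage/QuantumAdvantage/Statement.lean`:
`QuantumAdvantage := ∃ L, L ∈ BQP ∧ L ∉ BPP`), bearing on evidence FOR or AGAINST the summit from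
RANDOM oracles (Bennett–Gill style "random oracle hypothesis" arguments), as opposed to the
designed oracles of the sibling entries `Relativization.lean` and
`SupremacyTheoremsNonRelativizing.lean`.

**The printed results** (held arXiv copies; arXiv numbering).

* L. Fortnow, J. Rogers, *Complexity limitations on quantum computation*, JCSS 59 (1999)
  (arXiv:cs/9811023) [FortnowRogers1999JCSS], Thm. 4.4: "If `P = BQP` relative to random oracle
  then `BQP = BPP` (unrelativized)." (Proof: `L ∈ BQP` is in `BQP^R` for every `R`, hence in `P^R`
  for most `R`; Bennett–Gill: every such language is in `BPP`.)
* S. Aaronson, A. Ambainis, *The need for structure in quantum speedups*, Theory Comput. 10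
  (2014) (arXiv:0911.0996v3) [AaronsonAmbainis2014], Thm. 7 (iii): "Assume Conjecture 6
  [bounded polynomials have influential variables]. Then … (iii) If `P = P^{#P}`, then
  `BQP^A ⊂ AvgP^A` with probability `1` for a random oracle `A`", where (§1, p. 5) "`AvgP` is the
  class of languages for which there exists a polynomial-time algorithm that solves a `1 − o(1)`
  fraction of instances of size `n`. In other words, separating `BQP` from `AvgP` relative to a
  random oracle would be as hard as separating complexity classes in the unrelativized world."
  (Proof as Thm. 23, p. 14.) Conjecture 6 is the tree's `Literature.Computability.QuantumComplexity.AAConjecture`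
  (`AaronsonAmbainis.lean`, with Thm. 7 (i) as `AaronsonAmbainis2014_thm7`).

**What this file adds.** The two printed facts `fortnowRogers1999_thm44` and
`aaronsonAmbainis2014_thm7iii` (typed as printed, over the tree's random oracle
`randomOracleMeasure` = `randomOracle` and the relativized heuristic class `AvgPRel O` =
Aaronson–Ambainis' `AvgP^O`: a polynomial-time oracle machine correct on a `1 − o(1)` fraction of
the inputs of each length; NOT the relativization of the tree's errorless
`Literature.Computability.MetaComplexity.AvgP` of Bogdanov–Trevisan), the barrier decl
`RandomOracleMethod` (their conjunction) with the D-0021 block, and the proved readings: a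
random-oracle separation of `BQP` from `AvgP` refutes `P = P^{#P}` granted the Aaronson–Ambainis
conjecture (`P_ne_PSharpP_of_randomOracle_separation`), and under the summit `P = BQP` cannot
hold relative to a random oracle with probability `1` (`not_ae_P_eq_BQP_of_summit`).

The `AvgP^O` vocabulary (`errFraction`, `AvgPRel`, `PRel_subset_AvgPRel`) is DEFINED in the
fact-free module `Literature/Computability/Complexity/AvgPRel.lean` (namespace
`Literature.Computability.Complexity`), so that a route stating "`BQP^A ⊆ AvgP^A` almost surely"
by name need not import this barrier entry (whose imports carry `yamakawa_zhandry` and the open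
conjectures `AAConjecture` / `QuantumQuerySimulable`). The names
`Literature.Barriers.QuantumAdvantage.errFraction` / `….AvgPRel` / `….PRel_subset_AvgPRel`,
first declared here and used by `RandomOracleMethodProofs/Thm23/Holds.lean` and by route theses,
are kept below as REDUCIBLE SYNONYMS of those definitions (the gate pins a fully-qualified name to
its first module): the two spellings of any statement are definitionally equal, reducibly.

## Design notes

* `errFraction L f n` = fraction of `x ∈ {0,1}ⁿ` on which the answer `f x` differs from
  `[x ∈ L]` (`none`, i.e. no output within the round budget, counts as an error);
  "solves a `1 − o(1)` fraction" = `errFraction → 0` (`Filter.Tendsto … atTop (𝓝 0)`)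
  (definitions in `Complexity/AvgPRel.lean`; synonyms here).
* The machine model of `AvgPRel` is G01's transcript `OracleAlg` with polynomial round budget and
  polynomially bounded queries, literally as in `PRel` (so `PRel O ⊆ AvgPRel O`,
  `PRel_subset_AvgPRel`).
* Random oracle = the tree's `randomOracleMeasure` (synonym of `randomOracle` =
  `setBer(univ, 1/2)` on `Set (List Bool)`, samples read as `Language Bool`), as in
  `yamakawa_zhandry`.

## Sources

* [FortnowRogers1999JCSS] arXiv:cs/9811023 (read via `lit read arxiv:cs/9811023`): Thm. 4.4 and
  its proof (pp. 7–8), §4 closing remarks (p. 8).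
* [AaronsonAmbainis2014] arXiv:0911.0996v3 (read via `lit read arxiv:0911.0996`): §1 p. 5
  (AvgP, the quoted sentence, Impagliazzo–Rudich analogue), Conjecture 4, Conjecture 6, Thm. 7
  (pp. 5–6), Thm. 23 (p. 14), Thm. 26 (p. 15, the unconditional `BQP^{A[log]} ⊂ AvgP^A_{||}`
  under `P = P^{#P}`).
* [YamakawaZhandry2022] Thm. 1.1 — through the tree fact `Literature.Computability.QuantumComplexity.yamakawa_zhandry`.
* [AaronsonChen2017] §1 p. 6 (Fourier Sampling relative to a random oracle requires classical
  exponential time, citing Aaronson 2010).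
-/

noncomputable section

namespace Literature.Barriers.QuantumAdvantage

open MeasureTheory _root_.Computability Literature.Computability.Complexity Literature.Computability.Complexity.Classes Literature.Computability.Cryptography Literature.Computability.QuantumComplexity Filter

/-! ### Aaronson–Ambainis' `AvgP` relative to an oracle (synonyms of `Complexity/AvgPRel.lean`) -/

/-- The error fraction at length `n` of an answer function `f` for the language `L`: the
proportion of `x ∈ {0,1}ⁿ` with `f x ≠ some [x ∈ L]`. REDUCIBLE SYNONYM of
`Literature.Computability.Complexity.errFraction` (the definition; `errFraction_eq_complexity`),
kept under this name for the importers of this file. [cite: AaronsonAmbainis2014, §1 (p. 5, AvgP: solves a 1 − o(1) fraction of instances of size n)] -/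
abbrev errFraction (L : Language Bool) (f : List Bool → Option Bool) (n : ℕ) : ℝ :=
  Literature.Computability.Complexity.errFraction L f n

/-- The synonym is the definition of `Complexity/AvgPRel.lean` (by `rfl`). [folklore] -/
theorem errFraction_eq_complexity :
    @errFraction = @Literature.Computability.Complexity.errFraction :=
  rfl

/-- The synonym unfolded to the printed quotient `#{x ∈ {0,1}ⁿ : f x ≠ some [x ∈ L]} / 2ⁿ`.
[cite: AaronsonAmbainis2014, §1 (p. 5)] -/
theorem errFraction_eq_card_div (L : Language Bool) (f : List Bool → Option Bool) (n : ℕ) :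
    errFraction L f n =
      ((Finset.univ.filter fun x : List.Vector Bool n =>
          f x.toList ≠ some (L.boolIndicator x.toList)).card : ℝ) / 2 ^ n :=
  rfl

/-- The error fraction lies in `[0, 1]`: nonnegativity. [folklore] -/
theorem errFraction_nonneg (L : Language Bool) (f : List Bool → Option Bool) (n : ℕ) :
    0 ≤ errFraction L f n :=
  Literature.Computability.Complexity.errFraction_nonneg L f n

/-- A correct answer function has error fraction `0`. [folklore] -/
theorem errFraction_eq_zero_of_correct {L : Language Bool} {f : List Bool → Option Bool}
    (h : ∀ x, f x = some (L.boolIndicator x)) (n : ℕ) : errFraction L f n = 0 :=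
  Literature.Computability.Complexity.errFraction_eq_zero_of_correct h n

/-- `AvgPRel O = AvgP^O` (Aaronson–Ambainis): languages `L` for which some polynomial-time oracle
machine with oracle `O` (G01 transcript model, polynomial round budget and query length, as in
`PRel`) answers `[x ∈ L]` on a `1 − o(1)` fraction of the inputs of each length `n` (error
fraction tending to `0`). A HEURISTIC class (the machine may err), not the relativization of the
errorless `Literature.Computability.MetaComplexity.AvgP`. REDUCIBLE SYNONYM of
`Literature.Computability.Complexity.AvgPRel` (the definition; `AvgPRel_eq_complexity`), kept
under this name for the importers of this file and the route theses that cite it. [cite: AaronsonAmbainis2014, §1 (p. 5, definition of AvgP) and Thm. 23 (proof)] -/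
abbrev AvgPRel (O : Oracle) : Set (Language Bool) :=
  Literature.Computability.Complexity.AvgPRel O

/-- The synonym is the definition of `Complexity/AvgPRel.lean` (by `rfl`). [folklore] -/
theorem AvgPRel_eq_complexity : AvgPRel = Literature.Computability.Complexity.AvgPRel :=
  rfl

/-- `P^O ⊆ AvgP^O` (a machine that is always right errs on a `0` fraction). [folklore] -/
theorem PRel_subset_AvgPRel (O : Oracle) : PRel O ⊆ AvgPRel O :=
  Literature.Computability.Complexity.PRel_subset_AvgPRel O

/-! ### The printed facts -/

/-- **Fortnow–Rogers 1999, Thm. 4.4** (arXiv numbering): "If `P = BQP` relative to random oracle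
then `BQP = BPP` (unrelativized)." Hypothesis: `P^A = BQP^A` with probability `1` over the random
oracle `A` (tree `randomOracleMeasure`); conclusion: the class equality `BQP = BPP`.
[cite: FortnowRogers1999JCSS, Thm. 4.4 (arXiv numbering)] -/
def fortnowRogers1999_thm44 : Prop :=
  (∀ᵐ A ∂randomOracleMeasure, PRel (Oracle.ofLanguage (A : Language Bool)) = BQPRel (A : Language Bool)) →
    BQP = BPP

/-- **Aaronson–Ambainis 2014, Thm. 7 (iii)** (arXiv v3 numbering; proof as Thm. 23): "Assume
Conjecture 6. Then … if `P = P^{#P}`, then `BQP^A ⊂ AvgP^A` with probability `1` for a random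
oracle `A`" (`⊂` = inclusion). Conjecture 6 is the tree's `AAConjecture`. [cite: AaronsonAmbainis2014, Thm. 7 (iii) and Thm. 23] -/
def aaronsonAmbainis2014_thm7iii : Prop :=
  AAConjecture → P = PSharpP →
    ∀ᵐ A ∂randomOracleMeasure, BQPRel (A : Language Bool) ⊆ AvgPRel (Oracle.ofLanguage (A : Language Bool))

/-! ### The barrier -/

/-- **The random-oracle method neither separates nor collapses `BQP` versus classical polynomial
time for free** (Fortnow–Rogers Thm. 4.4; Aaronson–Ambainis Thm. 7 (iii)): the conjunction of
the two printed facts.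

BARRIER
technique_class: random-oracle, black-box, average-case oracle separations, Bennett–Gill random oracle hypothesis, unstructured oracles
blocks: (a) evidence AGAINST the summit by a random-oracle collapse: "`P^A = BQP^A` with probability `1`" already implies `BQP = BPP` unrelativized (`fortnowRogers1999_thm44`), so it cannot be had without settling the summit negatively; contrapositively, under the summit `P = BQP` fails to hold for a random oracle with probability `1` (`not_ae_P_eq_BQP_of_summit`, proved) [cite: FortnowRogers1999JCSS, Thm. 4.4 (arXiv numbering)]; (b) evidence FOR the summit by a random-oracle separation of `BQP` from heuristic classical polynomial time: granted the Aaronson–Ambainis conjecture (tree `AAConjecture`), `BQP^A ⊄ AvgP^A` on a positive-measure set of oracles refutes `P = P^{#P}` (`aaronsonAmbainis2014_thm7iii`; `P_ne_PSharpP_of_randomOracle_separation`, proved) — "separating `BQP` from `AvgP` relative to a random oracle would be as hard as separating complexity classes in the unrelativized world" [cite: AaronsonAmbainis2014, §1 (p. 5) and Thm. 7 (iii)]; unconditionally, `BQP` machines making `O(log n)` queries are already in `AvgP^A_{||}` for random `A` if `P = P^{#P}` [cite: AaronsonAmbainis2014, Thm. 26].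
because: a `BQP` language is in `BQP^R` for every `R`, so a probability-`1` collapse puts it in `P^R` for most `R`, and Bennett–Gill's argument places every such language in `BPP` [cite: FortnowRogers1999JCSS, proof of Thm. 4.4 (p. 8, arXiv numbering)]; under Conjecture 6 every `T`-query quantum algorithm is simulated to additive error `ε` on a `1 − δ` fraction of inputs by `poly(T, 1/ε, 1/δ)` deterministic classical queries (Thm. 7 (i), Conjecture 4), and with `P = P^{#P}` the simulation is made polynomial-TIME relative to `A`, the error fraction `δ_n(A) ≤ 1/n` for all but finitely many `n` with probability `1` (Borel–Cantelli), finitely many lengths being hard-wired [cite: AaronsonAmbainis2014, Thm. 7 (i), Conjecture 4 and Thm. 23 (proof, p. 14)].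
evasions_known: problems that are not languages decided on MOST inputs: relative to a random oracle, with probability `1`, there are `NP` SEARCH problems solvable in `BQP^A` but not in `BPP^A` (Yamakawa–Zhandry; tree fact `yamakawa_zhandry`) [cite: YamakawaZhandry2022, Thm. 1.1], and SAMPLING problems (Fourier Sampling) that are quantumly easy relative to a random oracle but require classical exponential time [cite: AaronsonChen2017, §1 (p. 6, citing Aaronson 2010)]; designed (non-random) oracles separate even `BQP` from `PH` (Raz–Tal; tree fact `exists_oracle_BQPRel_not_subset_PHRel`); the Aaronson–Ambainis conjecture itself is OPEN, so (b) is conditional [cite: AaronsonAmbainis2014, Conjecture 6 and Thm. 7].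
scope_caveats: (b) is doubly conditional (`AAConjecture`, and the conclusion is `P ≠ P^{#P}` only from a separation of `BQP^A` from the HEURISTIC class `AvgP^A`, not from `P^A` or `BPP^A`) and says nothing about separations on a measure-zero set of oracles; (a) concerns probability-`1` COLLAPSES only; `AvgPRel` is this file's rendering of Aaronson–Ambainis' informal `AvgP^A` ("solves a `1 − o(1)` fraction of instances of size `n`": deterministic transcript machine, `none` counts as error, error fraction `→ 0`), distinct from the tree's errorless `Literature.Computability.MetaComplexity.AvgP` [cite: AaronsonAmbainis2014, §1 (p. 5)]; Fortnow–Rogers' hypothesis and conclusion are typed as the printed equalities (`P^A = BQP^A` a.e., `BQP = BPP`), whose easy halves (`P^A ⊆ BQP^A`, `BPP ⊆ BQP`) are separate tree facts; random oracle = `setBer(univ, 1/2)` on languages, quantum access by XOR-query gates (`BQPRel`), classical by `Oracle.ofLanguage`.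
status: established for (a) (theorem in print); (b) is a theorem CONDITIONAL on the open Aaronson–Ambainis conjecture, typed with the conjecture as an explicit hypothesis [cite: FortnowRogers1999JCSS, Thm. 4.4 (arXiv numbering)] [cite: AaronsonAmbainis2014, Thm. 7 (iii)] -/
def RandomOracleMethod : Prop :=
  fortnowRogers1999_thm44 ∧ aaronsonAmbainis2014_thm7iii

/-- Projection. [cite: FortnowRogers1999JCSS, Thm. 4.4 (arXiv numbering)] -/
theorem RandomOracleMethod.thm44 (h : RandomOracleMethod) : fortnowRogers1999_thm44 :=
  h.1

/-- Projection. [cite: AaronsonAmbainis2014, Thm. 7 (iii)] -/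
theorem RandomOracleMethod.thm7iii (h : RandomOracleMethod) : aaronsonAmbainis2014_thm7iii :=
  h.2

/-! ### The no-go readings (proved) -/

/-- **(a)** Under the summit (`∃ L ∈ BQP, L ∉ BPP`), `P = BQP` does NOT hold relative to a random
oracle with probability `1` (contrapositive of Thm. 4.4). [cite: FortnowRogers1999JCSS, Thm. 4.4 (arXiv numbering)] -/
theorem not_ae_P_eq_BQP_of_summit (h : fortnowRogers1999_thm44)
    (hsummit : ∃ L : Language Bool, L ∈ BQP ∧ L ∉ BPP) :
    ¬ ∀ᵐ A ∂randomOracleMeasure,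
      PRel (Oracle.ofLanguage (A : Language Bool)) = BQPRel (A : Language Bool) := by
  intro hae
  obtain ⟨L, hL, hLB⟩ := hsummit
  exact hLB ((h hae) ▸ hL)

/-- **(a')** Equivalently: a probability-`1` random-oracle collapse `P^A = BQP^A` settles the
summit NEGATIVELY (`BQP ⊆ BPP`, route `Dequantize`'s thesis). [cite: FortnowRogers1999JCSS, Thm. 4.4 (arXiv numbering)] -/
theorem BQP_subset_BPP_of_ae_collapse (h : fortnowRogers1999_thm44)
    (hae : ∀ᵐ A ∂randomOracleMeasure,
      PRel (Oracle.ofLanguage (A : Language Bool)) = BQPRel (A : Language Bool)) :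
    BQP ⊆ BPP :=
  (h hae).le

/-- **(b)** Granted the Aaronson–Ambainis conjecture, a random-oracle separation of `BQP` from
`AvgP` — failure of "`BQP^A ⊆ AvgP^A` with probability `1`" — refutes `P = P^{#P}`: "separating
`BQP` from `AvgP` relative to a random oracle would be as hard as separating complexity classes in
the unrelativized world". [cite: AaronsonAmbainis2014, §1 (p. 5) and Thm. 7 (iii)] -/
theorem P_ne_PSharpP_of_randomOracle_separation (h : aaronsonAmbainis2014_thm7iii)
    (hAA : AAConjecture)
    (hsep : ¬ ∀ᵐ A ∂randomOracleMeasure,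
      BQPRel (A : Language Bool) ⊆ AvgPRel (Oracle.ofLanguage (A : Language Bool))) :
    P ≠ PSharpP :=
  fun hP => hsep (h hAA hP)

/-- **(b')** In particular (as `P^A ⊆ AvgP^A`, `PRel_subset_AvgPRel`): granted the conjecture and
`P = P^{#P}`, one cannot even have `BQP^A ⊄ P^A`-witnesses OUTSIDE `AvgP^A` almost surely — any
almost-sure separation must be from `P^A` but within `AvgP^A`. Formally: the set of oracles with
`BQP^A ⊆ AvgP^A` has full measure. [cite: AaronsonAmbainis2014, Thm. 7 (iii)] -/
theorem ae_BQPRel_subset_AvgPRel (h : aaronsonAmbainis2014_thm7iii) (hAA : AAConjecture)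
    (hP : P = PSharpP) :
    ∀ᵐ A ∂randomOracleMeasure,
      BQPRel (A : Language Bool) ⊆ AvgPRel (Oracle.ofLanguage (A : Language Bool)) :=
  h hAA hP

end Literature.Barriers.QuantumAdvantage

end
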